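import Mathlib
import HarnessLib
import Summits.HubbardSuperconductivity.HubbardSuperconductivity.Theorems.KLProgrammeC4aPreCausticLevelLineSplit

/-!
# Route `KLProgramme` — crux C4a, S3 brick (B4) «(U1)-LAWS» part 5b′ (PRIMED SIBLING of `…C4aPreCausticLevelLineSplit`): the pre-caustic level line with the split,
# with the support row in the TWO-SIDED form `|u| ≤ q_s·e ⇒ (K e)′u = 0` (`q_s ≥ 3/2`)

Cell `gate-hubbard-kl`, seat hubbard-kl-k3c3-p1 (g16; row «δμ-flow with klAngularMean constant piece»), by the pen's (R319)(E) ruling «RE-QUANTIFICATION = GO as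
PRIMED SIBLINGS, owner k3c3-p1» (k3c3-p3 g32, the author of part 5b, is closed).  Located point (L2) of the 02:05Z bus line: the original row
`hsupp : ∀ u ≤ q_s·e, (K e)′u = 0` is met by the one-sided kernel `K⁺` but by NO genuine finer-line partition piece (a physical piece-A kernel is alive at `e > 0`,
`u < −e(1−t₁)/t₁` — loop line finer, partner below the Fermi level, reached on post-side angles of the same box); the physical family
`…C4aPPKernelFamily.ppFamilyKernel` vanishes exactly on `|u| ≤ e(1−t₁)/t₁` (`…FamilySecond.deriv_ppFamilyKernel_eq_zero_of_abs_le`).  Part 5b USES the row only at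
`u = ē(e) ∈ [D − 3e/2, D − e/2]` and `u = D − e ≥ −e`, i.e. on `u ≥ −3e/2`, so the two-sided form with `q_s ≥ 3/2` suffices: this file is part 5b with that ONE
binder changed (`hqs : 3/2 ≤ q_s`, `hsupp : |u| ≤ q_s·e → …`) and the two application sites supplying the lower bound; every other line is k3c3-p3's proof verbatim.
* **`abs_intervalIntegral_levelLine_split_abs_le`** — statement and constants of `abs_intervalIntegral_levelLine_split_le`, support row two-sided.
Pure real analysis; nothing about the model; nothing asserts (C), K3 or superconductivity.
References: FST II CPAM 51 (1998) §3 [cite: FeldmanSalmhoferTrubowitz1998]; Salmhofer 1999 §4.5.3 [cite: Salmhofer1999].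
-/

noncomputable section

namespace Summit.HubbardSuperconductivity.HubbardSuperconductivity.Theorems.C4a

set_option linter.dupNamespace false -- summit = problem name (single-conjunct summit), D-0017

open Real Set MeasureTheory intervalIntegral
open scoped Interval

/-- **THE PRE-CAUSTIC LEVEL LINE WITH THE SPLIT, TWO-SIDED SUPPORT ROW** (primed sibling of `abs_intervalIntegral_levelLine_split_le`): levels `0 < lo ≤ hi`,
anti-diagonal level `D > 0`, split parameter `q_s ≥ 3/2` (`κ = 1/(q_s + 1/2)`); kernel `K e ∈ C²` with `|(K e)′u| ≤ 1/max(e,|u|)²`, `|(K e)″u| ≤ 1/max(e,|u|)³`,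
`(K e)′u = 0` for `|u| ≤ q_s·e`; flatness `|∫_{lo..hi} w·(K e)′(D − e)| ≤ A_fl`; weight `|X| ≤ X₀`, `|X e − X lo| ≤ X₁(e − lo)`; profile `0 ≤ w ≤ W`; the line `ē` with
`|ē(e) − (D − e)| ≤ e/2` and `≤ ρ` for `e ≤ κD` ⟹ `|∫_{lo..hi} w·X·(K e)′(ē e) de| ≤ X₀·A_fl + W·(X₀·(64/D³)·ρ + X₁·(4/D²)·(κD))·(κD)`.
[cite: FeldmanSalmhoferTrubowitz1998, §3] -/
theorem abs_intervalIntegral_levelLine_split_abs_le {K : ℝ → ℝ → ℝ} {w X eb : ℝ → ℝ} {lo hi D qs X₀ X₁ W Afl ρ : ℝ}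
    (hlo : 0 < lo) (hlohi : lo ≤ hi) (hD : 0 < D) (hqs : 3 / 2 ≤ qs) (hX₁ : 0 ≤ X₁) (hρ : 0 ≤ ρ)
    (hK : ∀ e ∈ Icc lo hi, ContDiff ℝ 2 (K e)) (hK1 : ∀ e ∈ Icc lo hi, ∀ u, |deriv (K e) u| ≤ (max e |u|)⁻¹ ^ 2)
    (hK2 : ∀ e ∈ Icc lo hi, ∀ u, |iteratedDeriv 2 (K e) u| ≤ (max e |u|)⁻¹ ^ 3)
    (hsupp : ∀ e ∈ Icc lo hi, ∀ u, |u| ≤ qs * e → deriv (K e) u = 0)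
    (hflat : |∫ e in lo..hi, w e * deriv (K e) (D - e)| ≤ Afl)
    (hfi : IntervalIntegrable (fun e => w e * X e * deriv (K e) (eb e)) volume lo hi)
    (hgi : IntervalIntegrable (fun e => w e * deriv (K e) (D - e)) volume lo hi)
    (hw0 : ∀ e ∈ Icc lo hi, 0 ≤ w e) (hwW : ∀ e ∈ Icc lo hi, w e ≤ W)
    (hX0 : ∀ e ∈ Icc lo hi, |X e| ≤ X₀) (hXL : ∀ e ∈ Icc lo hi, |X e - X lo| ≤ X₁ * |e - lo|)
    (hdev : ∀ e ∈ Icc lo hi, |eb e - (D - e)| ≤ e / 2) (hdevρ : ∀ e ∈ Icc lo hi, e ≤ D / (qs + 1 / 2) → |eb e - (D - e)| ≤ ρ) :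
    |∫ e in lo..hi, w e * X e * deriv (K e) (eb e)| ≤ X₀ * Afl + W * (X₀ * (64 / D ^ 3) * ρ + X₁ * (4 / D ^ 2) * (D / (qs + 1 / 2))) * (D / (qs + 1 / 2)) := by
  have hloI : lo ∈ Icc lo hi := left_mem_Icc.2 hlohi
  have hX00 : 0 ≤ X₀ := (abs_nonneg _).trans (hX0 lo hloI)
  have hW0 : 0 ≤ W := (hw0 lo hloI).trans (hwW lo hloI)
  have hqs0 : 0 < qs + 1 / 2 := by linarith
  set κD : ℝ := D / (qs + 1 / 2) with hκD
  have hκD0 : 0 < κD := div_pos hD hqs0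
  have hκDle : κD ≤ D := by rw [hκD, div_le_iff₀ hqs0]; nlinarith
  -- beyond `κD` both integrands vanish
  have hvan : ∀ e ∈ Icc lo hi, κD ≤ e → deriv (K e) (eb e) = 0 := fun e he hκe => by
    refine hsupp e he _ ?_
    have h1 := (abs_le.1 (hdev e he)).2
    have h1' := (abs_le.1 (hdev e he)).1
    have h2 : D ≤ (qs + 1 / 2) * e := by rwa [hκD, div_le_iff₀ hqs0, mul_comm] at hκe
    have he0 : 0 ≤ e := hlo.le.trans he.1
    rw [abs_le]; constructor <;> nlinarith
  have hvan' : ∀ e ∈ Icc lo hi, κD ≤ e → deriv (K e) (D - e) = 0 := fun e he hκe => by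
    refine hsupp e he _ ?_
    have h2 : D ≤ (qs + 1 / 2) * e := by rwa [hκD, div_le_iff₀ hqs0, mul_comm] at hκe
    have he0 : 0 ≤ e := hlo.le.trans he.1
    rw [abs_le]; constructor <;> nlinarith
  have hAfl0 : 0 ≤ Afl := (abs_nonneg _).trans hflat
  have hRHS0 : 0 ≤ X₀ * Afl + W * (X₀ * (64 / D ^ 3) * ρ + X₁ * (4 / D ^ 2) * κD) * κD := by positivity
  -- trivial case: the whole line lies beyond the split (`κD < lo`)
  rcases lt_or_ge κD lo with hsmall | hbig
  · have hzero : ∫ e in lo..hi, w e * X e * deriv (K e) (eb e) = 0 := by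
      rw [← intervalIntegral.integral_zero (a := lo) (b := hi)]
      refine intervalIntegral.integral_congr fun e he => ?_
      rw [uIcc_of_le hlohi] at he
      simp only [hvan e he (hsmall.le.trans he.1), mul_zero]
    rw [hzero, abs_zero]; exact hRHS0
  -- the truncation point `b = min hi κD ∈ [lo, hi]`
  set b : ℝ := min hi κD with hb
  have hlob : lo ≤ b := le_min hlohi hbig
  have hbhi : b ≤ hi := min_le_left _ _
  have hbκ : b ≤ κD := min_le_right _ _
  have hbsub : Icc lo b ⊆ Icc lo hi := Icc_subset_Icc le_rfl hbhi
  have hblen : b - lo ≤ κD := by linarith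
  -- split the two integrals at `b`; the tails vanish
  have htail : ∫ e in b..hi, w e * X e * deriv (K e) (eb e) = 0 := by
    rcases le_total κD hi with h | h
    · have hbeq : b = κD := by rw [hb, min_eq_right h]
      rw [← intervalIntegral.integral_zero (a := b) (b := hi)]
      refine intervalIntegral.integral_congr fun e he => ?_
      rw [uIcc_of_le hbhi] at he
      simp only [hvan e ⟨hlob.trans he.1, he.2⟩ (hbeq ▸ he.1), mul_zero]
    · have hbeq : b = hi := by rw [hb, min_eq_left h]
      rw [hbeq, intervalIntegral.integral_same]
  have htail' : ∫ e in b..hi, w e * deriv (K e) (D - e) = 0 := by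
    rcases le_total κD hi with h | h
    · have hbeq : b = κD := by rw [hb, min_eq_right h]
      rw [← intervalIntegral.integral_zero (a := b) (b := hi)]
      refine intervalIntegral.integral_congr fun e he => ?_
      rw [uIcc_of_le hbhi] at he
      simp only [hvan' e ⟨hlob.trans he.1, he.2⟩ (hbeq ▸ he.1), mul_zero]
    · have hbeq : b = hi := by rw [hb, min_eq_left h]
      rw [hbeq, intervalIntegral.integral_same]
  have hfi' : IntervalIntegrable (fun e => w e * X e * deriv (K e) (eb e)) volume lo b :=
    hfi.mono_set (by rw [uIcc_of_le hlohi, uIcc_of_le hlob]; exact hbsub)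
  have hgi' : IntervalIntegrable (fun e => w e * deriv (K e) (D - e)) volume lo b :=
    hgi.mono_set (by rw [uIcc_of_le hlohi, uIcc_of_le hlob]; exact hbsub)
  have hfi'' : IntervalIntegrable (fun e => w e * X e * deriv (K e) (eb e)) volume b hi :=
    hfi.mono_set (by rw [uIcc_of_le hlohi, uIcc_of_le hbhi]; exact Icc_subset_Icc hlob le_rfl)
  have hgi'' : IntervalIntegrable (fun e => w e * deriv (K e) (D - e)) volume b hi :=
    hgi.mono_set (by rw [uIcc_of_le hlohi, uIcc_of_le hbhi]; exact Icc_subset_Icc hlob le_rfl)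
  have hsplit1 : ∫ e in lo..hi, w e * X e * deriv (K e) (eb e) = ∫ e in lo..b, w e * X e * deriv (K e) (eb e) := by
    rw [← intervalIntegral.integral_add_adjacent_intervals hfi' hfi'', htail, add_zero]
  have hsplit2 : ∫ e in lo..hi, w e * deriv (K e) (D - e) = ∫ e in lo..b, w e * deriv (K e) (D - e) := by
    rw [← intervalIntegral.integral_add_adjacent_intervals hgi' hgi'', htail', add_zero]
  rw [hsplit1]
  rw [hsplit2] at hflat
  -- kernel data on the truncated line from the envelopes
  have heD : ∀ e ∈ Icc lo b, e ≤ D := fun e he => (he.2.trans hbκ).trans hκDle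
  have hB₁ : ∀ e ∈ Icc lo b, |deriv (K e) (D - e)| ≤ 4 / D ^ 2 := fun e he => by
    have he0 : 0 < e := hlo.trans_le he.1
    refine (hK1 e (hbsub he) (D - e)).trans ?_
    have hm : D / 2 ≤ max e |D - e| := by
      rcases le_total (D / 2) e with h | h
      · exact le_max_of_le_left h
      · exact le_max_of_le_right (by rw [abs_of_nonneg (by linarith [heD e he])]; linarith)
    rw [inv_pow, show (4 : ℝ) / D ^ 2 = ((D / 2) ^ 2)⁻¹ by field_simp; norm_num]
    exact inv_anti₀ (by positivity) (pow_le_pow_left₀ (by positivity) hm 2)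
  have hB₂ : ∀ e ∈ Icc lo b, ∀ u : ℝ, |u - (D - e)| ≤ D / 2 → |deriv (K e) u - deriv (K e) (D - e)| ≤ 64 / D ^ 3 * |u - (D - e)| := by
    intro e he u hu
    have he0 : 0 < e := hlo.trans_le he.1
    have hKe := hK e (hbsub he)
    have hdiff : Differentiable ℝ (deriv (K e)) := by
      have h : Differentiable ℝ (iteratedDeriv 1 (K e)) := ContDiff.differentiable_iteratedDeriv 1 hKe (by norm_num)
      rwa [iteratedDeriv_one] at h
    have hd2 : ∀ x, deriv (deriv (K e)) x = iteratedDeriv 2 (K e) x := fun x => by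
      rw [show iteratedDeriv 2 (K e) = deriv (iteratedDeriv 1 (K e)) from iteratedDeriv_succ, iteratedDeriv_one]
    -- on the segment the envelope floor is `D/4`
    have hseg : ∀ x ∈ uIcc (D - e) u, ‖deriv (deriv (K e)) x‖ ≤ 64 / D ^ 3 := fun x hx => by
      rw [Real.norm_eq_abs, hd2]
      refine (hK2 e (hbsub he) x).trans ?_
      have hxd : |x - (D - e)| ≤ D / 2 := by
        have hu1 := (abs_le.1 hu).1
        have hu2 := (abs_le.1 hu).2
        rcases le_total (D - e) u with h | h
        · rw [uIcc_of_le h] at hx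
          rw [abs_le]; constructor
          · linarith [hx.1]
          · linarith [hx.2]
        · rw [uIcc_of_ge h] at hx
          rw [abs_le]; constructor
          · linarith [hx.1]
          · linarith [hx.2]
      have hm : D / 4 ≤ max e |x| := by
        rcases le_total (D / 4) e with h | h
        · exact le_max_of_le_left h
        · refine le_max_of_le_right ?_
          have : D / 4 ≤ x := by have := (abs_le.1 hxd).1; linarith [heD e he]
          exact this.trans (le_abs_self x)
      rw [inv_pow, show (64 : ℝ) / D ^ 3 = ((D / 4) ^ 3)⁻¹ by field_simp; norm_num]
      exact inv_anti₀ (by positivity) (pow_le_pow_left₀ (by positivity) hm 3)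
    have hmvt := Convex.norm_image_sub_le_of_norm_deriv_le (fun x _ => hdiff.differentiableAt) hseg
      (convex_uIcc (D - e) u) left_mem_uIcc right_mem_uIcc
    rwa [Real.norm_eq_abs, Real.norm_eq_abs] at hmvt
  -- the uniform level-line law on `[lo, b]`
  have hfi3 : IntervalIntegrable (fun e => w e * X e * deriv (K e) (D - e + (eb e - (D - e)))) volume lo b := by
    simpa only [show ∀ e, D - e + (eb e - (D - e)) = eb e from fun e => by ring] using hfi'
  have hmain := abs_intervalIntegral_deformed_antidiagonal_le_unif (Ku := fun e u => deriv (K e) u) (r := fun e => eb e - (D - e)) (ρ₀ := D / 2)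
    hlob (left_mem_Icc.2 hlob) hfi3 hgi'
    (fun e he => hw0 e (hbsub he)) (fun e he => hwW e (hbsub he)) (fun e he => hX0 e (hbsub he)) (fun e he => hXL e (hbsub he)) hX₁
    (fun e he => hdevρ e (hbsub he) (he.2.trans hbκ)) (fun e he => (hdev e (hbsub he)).trans (by linarith [heD e he]))
    hB₁ (by positivity) hB₂ hflat
  simp only [show ∀ e, D - e + (eb e - (D - e)) = eb e from fun e => by ring] at hmain
  refine hmain.trans ?_
  have hbl0 : 0 ≤ b - lo := sub_nonneg.2 hlob
  have hin : X₀ * (64 / D ^ 3) * ρ + X₁ * (4 / D ^ 2) * (b - lo) ≤ X₀ * (64 / D ^ 3) * ρ + X₁ * (4 / D ^ 2) * κD := by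
    have := mul_le_mul_of_nonneg_left hblen (by positivity : 0 ≤ X₁ * (4 / D ^ 2)); linarith
  have h0' : 0 ≤ X₀ * (64 / D ^ 3) * ρ + X₁ * (4 / D ^ 2) * κD := by positivity
  have hprod := mul_le_mul hin hblen hbl0 h0'
  have := mul_le_mul_of_nonneg_left hprod hW0
  linarith

end Summit.HubbardSuperconductivity.HubbardSuperconductivity.Theorems.C4a

end
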